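/-
Copyright (c) 2026 the pub-hodgecm-mathlib formalisation cell (harness21).  Prover seat hodgecm-mathlib-LH4-p19 (g3), req620 Track A «(D-RAM) FOUR-FRAME» squad
(STAGE-1b, row (2) of the piece `f_{T₊}`, the (β₂) road (R-36) «PURE-CELL LEDGER»; β₂ WORD #29∕#31 «p19: RAY BANDS» — the index-two class letters of the type-RamK (lane B)
one-field frame, discharged from the ‹OFF.letter.v2› block letters), 2026-09-05.
-/
import Summits.HodgeConjecture.HodgeConjecture.Theorems.F0P3cDyRamToricLevelCensusRamKAtThirdField   -- ★ (LH4-p07 (g7)): `exists_thirdFieldPackage_ramK` (the third field `Fix Θ` as a valued field)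
import Summits.HodgeConjecture.HodgeConjecture.Theorems.F0P3cDyRamThirdFieldPackageUnr              -- ★ (LH4-p12): `exists_unit_mul_map_eq` (unit-norm surjectivity of an unramified involution)
import Summits.HodgeConjecture.HodgeConjecture.Theorems.F0P3cDyRamRowVertexPopulationRead           -- ★ p863859 (LH4-p16 (g2)): `fixedNorm_map_iff`; brings ★ DEFS
import Summits.HodgeConjecture.HodgeConjecture.Theorems.F0P3cDyRamDiagonalCellCleanRegime           -- ★ (this lineage): `v_map_le_pow_iff`
import Literature.NumberTheory.LocalFields.WildQuadraticDatumNonNormUnit                            -- ★ Lit: `exists_unit_nonnorm_dichotomy_of_isRamifiedQuadraticDatum`, `exists_fixed_unit_not_norm_of_isRamifiedQuadraticDatum`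
import Literature.NumberTheory.LocalFields.WildQuadraticDatumNormSignConductor                      -- ★ Lit: `exists_mul_map_eq_of_fixed_of_v_sub_one_le_pred` (deep fixed units are norms)
import Literature.NumberTheory.LocalFields.ValuedCompleteIsAdicComplete                             -- ★ BRIDGE-AC: `isAdicComplete_valuedInteger_of_completeSpace`
import HarnessLib

/-!
# Crux `H413`, line LH4 «(D-RAM) FOUR-FRAME» — STAGE-1b, row (2), the (β₂) road (R-36), (OFF) residue, lane B (type RamK): «THE CLASS LETTERS OF THE FRAME» — `hFgap`, `hdeep`,
# the `Θ`-dichotomy `hdich` and the flip witness `hwit` (= lane C's frame letter `_c20`), DISCHARGED from the ‹OFF.letter.v2› block letters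

Cell `hodgecm-mathlib` (D-0151), FLOOR 0, crux item H413 = `stmt-HodgeConjecture-24833`, route of record `HCCMUnconditional`; squad F0∕P3c∕LH4; lane
`--supports stmt-HodgeConjecture-24833 --as helper` (count-neutral; pays NO tier-0 row).  THEOREMS ONLY (no `def`, no instance, no notation, no `sorry`, default heartbeats);
★-only imports; states NO law; (β₂) stays a HYPOTHESIS.  One-field frame of type RamK (lane B): `M` complete with finite residue field, `ρ`, `Θ` commuting isometric involutions,
`Fix ρ = jE(E)` (`Θ∘jE = jE∘σ`, `|jE a| = |a|`), `M∕E` unramified (`|α − ρα| = 1`), a ramified `Θ`-datum `(Θ, jEϖ, d, tE)`, `#𝓀[M] = #𝓀[E]²`, `hσres`, `hτ`.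

WHY (β₂ WORD #29 «p19: RAY BANDS»; ★ p864078 (LH4-p18 (g4)) (hF), ★ p863983 (hLit), ★ `…RowCellGeneratorIndependence` (LH7-p06 (g3)) (hI), ★ p863914 (hV)(hP)).  The payers of
the count socket's letters take four CLASS LETTERS of the one-field frame as binders: `hFgap` («no doubly-fixed valuation strictly between `|ϖE|` and `1`»), `hdeep` («deep doubly-fixed
units are `Θ`-norms of `ρ`-fixed elements»), `hdich` (the unit `Θ`-dichotomy of `M ∕ Fix Θ`) and `hwit` («some `Θ`-fixed unit has a `ρ`-norm outside the `E∕F`-norm class» — lane C's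
block letter `_c20`).  The lane-B block ‹OFF.letter.v2› carries none of them as letters; THIS FILE derives all four from its letters, so the upper-line assembler (this seat's R1)
can instantiate the ★ payers: `hFgap` from the even-valuation clause of the `Θ`-datum; `hdeep` from ★ Lit `exists_mul_map_eq_of_fixed_of_v_sub_one_le_pred` on `E` through `jE`;
`hdich` = ★ Lit `exists_unit_nonnorm_dichotomy_of_isRamifiedQuadraticDatum` on `(M, Θ, jEϖ)`; `hwit` through the THIRD FIELD: ★ `exists_thirdFieldPackage_ramK` presents
`K♮ = Fix Θ` as a complete valued field `K′` with finite residue field and an UNRAMIFIED involution `σ′ = ρ|_{K♮}` (`|α′ − σ′α′| = 1`), so ★ `exists_unit_mul_map_eq` (Serre V §2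
Prop. 3: `U_F = N(U_{K♮})`) writes the image `jE u₀` of a non-norm fixed unit `u₀` of `E` (★ Lit `exists_fixed_unit_not_norm_of_isRamifiedQuadraticDatum`) as `a·ρa` with `a = jK ω`
`Θ`-fixed — and `jE u₀ ∉ {eΘe : ρe = e}` (★ `fixedNorm_map_iff`).
* §1 `fgap_of_datum`, `deep_of_datum`, `dich_of_datum`.  §2 HEAD `exists_flipWitness_of_frame` (= `hwit`).  §3 `exists_refPair_of_frame` — a reference pair `(κ₀, ξ₀) ⊂ Fix Θ` of the
  line `Tr_ρ = 1` with `|κ₀| ≤ 1`, `|ξ₀| = exp(2n)` (the cell-adapted pair of ★ p863914's (hV) at an even cell index `j − b = 2n`).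
HONEST LABEL.  Count-neutral local algebra; nothing printed is asserted; no census law is stated; `hU_ray`, `hD_ray`, `hL_ray` stay OPEN; `HC_CM` is proved only modulo the 7 printed
citations (2 remaining named inputs: hLiu418 = `stmt-HodgeConjecture-24832`, h413 = `stmt-HodgeConjecture-24833`) until rung 0 closes.
## References
* [Serre1979] J.-P. Serre, *Local Fields*, GTM 67 (1979): Ch. V §2 Prop. 3 (unramified unit norms), Ch. V §3 Prop. 5, Cor. 2–3 (conductor; index two), Ch. XIV §6.
* [Jacobowitz1962] R. Jacobowitz, *Hermitian forms over local fields*, Amer. J. Math. 84 (1962): §4.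
* [Kottwitz1986BaseChangeUnits] R. E. Kottwitz, *Base change for unit elements of Hecke algebras*, Compositio Math. 60 (1986): §1 pp. 240–241.
-/

set_option autoImplicit false

noncomputable section

namespace Summit.HodgeConjecture.HodgeConjecture.Cruxes.H413.F0P3cDyRamRamKFrameClassLetters

open scoped Valued WithZero
open WithZero
open Literature.NumberTheory.Automorphic.UnitaryThreeFourFrame (IsRamifiedQuadraticDatum)
open Literature.NumberTheory.LocalFields (isAdicComplete_valuedInteger_of_completeSpace)
open Literature.NumberTheory.LocalFields.WildQuadraticDatum (exists_unit_nonnorm_dichotomy_of_isRamifiedQuadraticDatum exists_fixed_unit_not_norm_of_isRamifiedQuadraticDatum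
  exists_mul_map_eq_of_fixed_of_v_sub_one_le_pred)
open Summit.HodgeConjecture.HodgeConjecture.Cruxes.H413.F0P3cDyRamRowVertexPopulationRead (fixedNorm_map_iff)
open Summit.HodgeConjecture.HodgeConjecture.Cruxes.H413.F0P3cDyRamDiagonalCellCleanRegime (v_map_le_pow_iff)
open Summit.HodgeConjecture.HodgeConjecture.Cruxes.H413.F0P3cDyRamToricLevelCensusRamKAtThirdField (exists_thirdFieldPackage_ramK)
open Summit.HodgeConjecture.HodgeConjecture.Cruxes.H413.F0P3cDyRamThirdFieldPackageUnr (exists_unit_mul_map_eq)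

variable {E M : Type} [Field E] [Valued E ℤᵐ⁰] [Field M] [Valued M ℤᵐ⁰] {ρ Θ : M →+* M} {α : M}

/-! ## §1 `hFgap`, `hdeep`, `hdich` -/

omit [Field E] [Valued E ℤᵐ⁰] in
/-- **`hFgap` FROM THE `Θ`-DATUM**: the even-valuation clause of `IsRamifiedQuadraticDatum Θ ϖM d t` (`Θ`-fixed non-zero elements have valuation `exp(2n)`) and `|ϖM| = exp(−1)` give:
no `Θ`-fixed (a fortiori no doubly-fixed) element has valuation strictly between `|ϖM|` and `1`. [cite: Serre1979, Ch. V §3] -/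
theorem fgap_of_datum {ϖM : M} {d t : ℕ} (hDM : IsRamifiedQuadraticDatum Θ ϖM d t) :
    ∀ z : M, ρ z = z → Θ z = z → Valued.v ϖM < Valued.v z → Valued.v z ≤ 1 → Valued.v z = 1 := by
  obtain ⟨-, -, hϖM, heven, -, -, -⟩ := hDM
  intro z _ hΘz hlt hle
  have hz0 : z ≠ 0 := fun h0 => by rw [h0, map_zero] at hlt; exact not_lt_of_ge zero_le hlt
  obtain ⟨n, hn⟩ := heven z hΘz hz0
  rw [hn] at hlt hle ⊢
  rw [hϖM, exp_lt_exp] at hlt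
  rw [← exp_zero, exp_le_exp] at hle
  rw [← exp_zero]; congr 1; omega

/-- **`hdeep` FROM THE `E`-DATUM**: on a complete `E`, a doubly-fixed `u ∈ M` with `|u − 1| ≤ |jEϖ|^n`, `2d − 1 ≤ n`, is `eΘe` for a `ρ`-fixed `e` (`u = jE u′`, `u′` a fixed element
`|ϖ|^n`-close to `1` is an `E∕F`-norm, ★ Lit). [cite: Serre1979, Ch. V §3 Cor. 3; Ch. XV §2] -/
theorem deep_of_datum [CompleteSpace E] {σ : E →+* E} {ϖ : E} {d t : ℕ} (hD : IsRamifiedQuadraticDatum σ ϖ d t)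
    (jE : E →+* M) (hjv : ∀ c, Valued.v (jE c) ≤ 1 ↔ Valued.v c ≤ 1) (hjfix : ∀ z, ρ z = z ↔ ∃ c, jE c = z) (hΘj : ∀ c, Θ (jE c) = jE (σ c))
    {n : ℕ} (hn : 2 * d - 1 ≤ n) :
    ∀ u : M, ρ u = u → Θ u = u → Valued.v (u - 1) ≤ Valued.v (jE ϖ) ^ n → ∃ c : M, ρ c = c ∧ c * Θ c = u := by
  have hϖ : Valued.v ϖ = exp (-1 : ℤ) := hD.2.2.1
  have hϖ0 : ϖ ≠ 0 := fun h0 => by rw [h0, map_zero] at hϖ; exact (exp_ne_zero hϖ.symm).elim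
  intro u hρu hΘu hu
  obtain ⟨u', rfl⟩ := (hjfix u).1 hρu
  have hσu' : σ u' = u' := jE.injective (by rw [← hΘj, hΘu])
  have hu' : Valued.v (u' - 1) ≤ Valued.v ϖ ^ n := (v_map_le_pow_iff jE hjv hϖ0 (u' - 1) n).1 (by rw [map_sub, map_one]; exact hu)
  exact (fixedNorm_map_iff jE hjfix hΘj u').2 (exists_mul_map_eq_of_fixed_of_v_sub_one_le_pred hD hσu' hn hu')

omit [Field E] [Valued E ℤᵐ⁰] in
/-- **`hdich` FROM THE `Θ`-DATUM**: on a complete `M` with finite residue field, the unit `Θ`-dichotomy of `M ∕ Fix Θ` with a `Θ`-fixed unit non-norm `c₀` (★ Lit).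
[cite: Serre1979, Ch. V §3 Prop. 5, Cor. 2–3] -/
theorem dich_of_datum [CompleteSpace M] [Finite 𝓀[M]] {ϖM : M} {d t : ℕ} (hDM : IsRamifiedQuadraticDatum Θ ϖM d t) :
    ∃ c₀ : M, Θ c₀ = c₀ ∧ Valued.v c₀ = 1 ∧ (¬ ∃ z : M, z * Θ z = c₀) ∧
      ∀ x : M, Θ x = x → Valued.v x = 1 → (∃ z : M, z * Θ z = x) ∨ ∃ z : M, z * Θ z = c₀ * x := by
  haveI := isAdicComplete_valuedInteger_of_completeSpace (K := M) hDM.2.2.1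
  exact exists_unit_nonnorm_dichotomy_of_isRamifiedQuadraticDatum Θ ϖM d t hDM

/-! ## §2 HEAD — the flip witness `hwit` through the third field -/

/-- **HEAD — THE FLIP WITNESS `hwit` OF THE TYPE-RamK FRAME**: `M` complete with finite residue field; `ρ`, `Θ` commuting isometric involutions; `M ∕ E` unramified (`|α| ≤ 1`,
`|α − ρα| = 1`); the ramified `Θ`-datum `(Θ, jEϖ, d, tE)`; `#𝓀[M] = q²`; `hσres`, `hτ`; `E` complete with finite residue field carrying the datum `(σ, ϖ, d, tE)`, `Fix ρ = jE(E)`,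
`Θ∘jE = jE∘σ`, `|jE a| = |a|`.  THEN `∃ a : M, Θa = a ∧ |a| = 1 ∧ ¬ ∃ e, ρe = e ∧ eΘe = a·ρa` — the unramified norm `K♮ → F` hits the non-`E∕F`-norm unit class.
[cite: Serre1979, Ch. V §2 Prop. 3; Ch. V §3 Cor. 3] [cite: Kottwitz1986BaseChangeUnits, §1 pp. 240–241] -/
theorem exists_flipWitness_of_frame [CompleteSpace E] [Finite 𝓀[E]] [CompleteSpace M] [Finite 𝓀[M]]
    {σ : E →+* E} {ϖ : E} {d tE : ℕ} (hD : IsRamifiedQuadraticDatum σ ϖ d tE)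
    (jE : E →+* M) (hjiso : ∀ a, Valued.v (jE a) = Valued.v a) (hjfix : ∀ z, ρ z = z ↔ ∃ c, jE c = z) (hΘj : ∀ c, Θ (jE c) = jE (σ c))
    (hρρ : ∀ x, ρ (ρ x) = x) (hvρ : ∀ x, Valued.v (ρ x) = Valued.v x) (hΘρ : ∀ x, Θ (ρ x) = ρ (Θ x))
    (hα1 : Valued.v α ≤ 1) (hU : Valued.v (α - ρ α) = 1) (hDM : IsRamifiedQuadraticDatum Θ (jE ϖ) d tE)
    {q : ℕ} (hq : Nat.card 𝓀[M] = q ^ 2)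
    (hσres : ∀ z : M, ρ z = z → Valued.v z ≤ 1 → Valued.v (Θ z - z) < 1) (hτ : Valued.v (α - Θ α) < 1) :
    ∃ a : M, Θ a = a ∧ Valued.v a = 1 ∧ ¬ ∃ e : M, ρ e = e ∧ e * Θ e = a * ρ a := by
  haveI := isAdicComplete_valuedInteger_of_completeSpace (K := E) hD.2.2.1
  -- a fixed unit of `E` which is not an `E∕F`-norm
  obtain ⟨u₀, hσu₀, hu₀1, hu₀n⟩ := exists_fixed_unit_not_norm_of_isRamifiedQuadraticDatum σ ϖ d tE hD
  -- the third field `K♮ = Fix Θ` as a valued field with the unramified involution `σ′ = ρ|`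
  obtain ⟨K', _iF, _iV, σ', α', π', jK, _hDVR, hfin, hcs, hσ'σ', hvσ', hα'1, hα'σ', hπ', -, hjKv, hjKΘ, hjKonto, hjKσ⟩ :=
    exists_thirdFieldPackage_ramK hρρ hvρ hΘρ hα1 hU hDM hq hσres hτ
  haveI : Finite 𝓀[K'] := hfin
  haveI : CompleteSpace K' := hcs
  -- `jE u₀` is `Θ`-fixed, hence `= jK x` with `x` a `σ′`-fixed unit of `K′`
  have hΘz : Θ (jE u₀) = jE u₀ := by rw [hΘj, hσu₀]
  obtain ⟨x, hx⟩ := hjKonto (jE u₀) hΘz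
  have hx1 : Valued.v x = 1 := by
    have h2 : Valued.v x ^ 2 = 1 := by rw [← hjKv, hx, hjiso, hu₀1]
    rcases lt_trichotomy (Valued.v x) 1 with h | h | h
    · exact absurd h2 (pow_lt_one₀ zero_le h two_ne_zero).ne
    · exact h
    · exact absurd h2 (one_lt_pow₀ h two_ne_zero).ne'
  have hx0 : x ≠ 0 := fun h0 => by rw [h0, map_zero] at hx1; exact zero_ne_one hx1
  have hσ'x : σ' x = x := jK.injective (by rw [hjKσ, hx]; exact (hjfix _).2 ⟨u₀, rfl⟩)
  -- Serre V §2 Prop. 3 on `K′`: `x = ω·σ′ω`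
  have hα'' : Valued.v (σ' α' - α') = 1 := by rw [Valuation.map_sub_swap]; exact hα'σ'
  obtain ⟨ω, hω1, hωx⟩ := exists_unit_mul_map_eq hσ'σ' hvσ' hα'1 hα'' hπ' (Units.mk0 x hx0) (by rw [Units.val_mk0]; exact hσ'x) (by rw [Units.val_mk0]; exact hx1)
  rw [Units.val_mk0] at hωx
  refine ⟨jK ω, hjKΘ _, by rw [hjKv, hω1, one_pow], ?_⟩
  rintro ⟨e, hρe, hee⟩
  have hnorm : jK (ω : K') * ρ (jK ω) = jE u₀ := by rw [← hjKσ, ← map_mul, hωx, hx]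
  rw [hnorm] at hee
  exact hu₀n ((fixedNorm_map_iff jE hjfix hΘj u₀).1 ⟨e, hρe, hee⟩)

/-! ## §3 A doubly-adapted reference pair of prescribed even size -/

/-- **A REFERENCE PAIR `(κ₀, ξ₀)` OF THE LINE `Tr_ρ = 1` INSIDE `Fix Θ`, OF PRESCRIBED EVEN SIZE**: same frame; for every `n : ℕ` there are `κ₀, ξ₀ ∈ Fix Θ` with `Tr_ρ κ₀ = 1`,
`ρξ₀ = −ξ₀ ≠ 0`, `|κ₀| ≤ 1` and `|ξ₀| = exp(2n)` (`ξ₀ = jK(α′ − σ′α′)·jE((ϖσϖ)⁻ⁿ)`, `κ₀ = jK α′ ∕ jK(α′ − σ′α′)` from the third field's unramified generator `α′`) — the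
reference pair of ★ p863914 ∕ ★ p864078 ∕ ★ LH7-p06 at the cell's radius `R = |ϖE|^b ∕ |cc(α − ρα)| = exp(j − b)` when `j − b = 2n`. [cite: Serre1979, Ch. V §2 Prop. 3; Ch. III §6 Prop. 12] -/
theorem exists_refPair_of_frame [CompleteSpace M] [Finite 𝓀[M]]
    {σ : E →+* E} {ϖ : E} {d tE : ℕ} (hD : IsRamifiedQuadraticDatum σ ϖ d tE)
    (jE : E →+* M) (hjiso : ∀ a, Valued.v (jE a) = Valued.v a) (hjfix : ∀ z, ρ z = z ↔ ∃ c, jE c = z) (hΘj : ∀ c, Θ (jE c) = jE (σ c))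
    (hρρ : ∀ x, ρ (ρ x) = x) (hvρ : ∀ x, Valued.v (ρ x) = Valued.v x) (hΘρ : ∀ x, Θ (ρ x) = ρ (Θ x))
    (hα1 : Valued.v α ≤ 1) (hU : Valued.v (α - ρ α) = 1) (hDM : IsRamifiedQuadraticDatum Θ (jE ϖ) d tE)
    {q : ℕ} (hq : Nat.card 𝓀[M] = q ^ 2)
    (hσres : ∀ z : M, ρ z = z → Valued.v z ≤ 1 → Valued.v (Θ z - z) < 1) (hτ : Valued.v (α - Θ α) < 1) (n : ℕ) :
    ∃ κ₀ ξ₀ : M, κ₀ + ρ κ₀ = 1 ∧ Θ κ₀ = κ₀ ∧ ρ ξ₀ = -ξ₀ ∧ Θ ξ₀ = ξ₀ ∧ ξ₀ ≠ 0 ∧ Valued.v κ₀ ≤ 1 ∧ Valued.v ξ₀ = exp (2 * (n : ℤ)) := by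
  obtain ⟨hσσ, hvσ, hϖ, -, -, -, -⟩ := id hD
  obtain ⟨K', _iF, _iV, σ', α', π', jK, _hDVR, _hfin, _hcs, hσ'σ', hvσ', hα'1, hα'σ', -, -, hjKv, hjKΘ, -, hjKσ⟩ :=
    exists_thirdFieldPackage_ramK hρρ hvρ hΘρ hα1 hU hDM hq hσres hτ
  -- the unit anti element `ξ₁ = jK(α′ − σ′α′)` and `κ₁ = jK α′ ∕ ξ₁`
  set ξ₁ : M := jK (α' - σ' α') with hξ₁
  have hξ₁v : Valued.v ξ₁ = 1 := by rw [hξ₁, hjKv, hα'σ', one_pow]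
  have hξ₁0 : ξ₁ ≠ 0 := fun h0 => by rw [h0, map_zero] at hξ₁v; exact zero_ne_one hξ₁v
  have hρξ₁ : ρ ξ₁ = -ξ₁ := by rw [hξ₁, ← hjKσ, map_sub, hσ'σ', ← map_neg, neg_sub]
  have hΘξ₁ : Θ ξ₁ = ξ₁ := hjKΘ _
  -- the doubly fixed scaling `P₀ = jE(ϖσϖ)`, `|P₀| = exp(−2)`
  set P₀ : M := jE (ϖ * σ ϖ) with hP₀
  have hP₀v : Valued.v P₀ = exp (-2 : ℤ) := by rw [hP₀, hjiso, Valuation.map_mul, hvσ, hϖ, ← exp_add]; norm_num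
  have hP₀0 : P₀ ≠ 0 := fun h0 => by rw [h0, map_zero] at hP₀v; exact (exp_ne_zero hP₀v.symm).elim
  have hρP₀ : ρ P₀ = P₀ := (hjfix _).2 ⟨_, rfl⟩
  have hΘP₀ : Θ P₀ = P₀ := by rw [hP₀, hΘj, map_mul, hσσ, mul_comm]
  refine ⟨jK α' / ξ₁, ξ₁ * (P₀ ^ n)⁻¹, ?_, ?_, ?_, ?_, mul_ne_zero hξ₁0 (inv_ne_zero (pow_ne_zero _ hP₀0)), ?_, ?_⟩
  · rw [map_div₀, hρξ₁, ← hjKσ, div_neg, ← sub_eq_add_neg, ← sub_div, ← map_sub, ← hξ₁, div_self hξ₁0]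
  · rw [map_div₀, hjKΘ, hΘξ₁]
  · rw [map_mul, hρξ₁, map_inv₀, map_pow, hρP₀, neg_mul]
  · rw [map_mul, hΘξ₁, map_inv₀, map_pow, hΘP₀]
  · rw [map_div₀, hξ₁v, div_one, hjKv]; exact pow_le_one₀ zero_le hα'1
  · rw [Valuation.map_mul, hξ₁v, one_mul, map_inv₀, Valuation.map_pow, hP₀v, ← exp_nsmul, ← exp_neg]
    congr 1; rw [nsmul_eq_mul]; ring

end Summit.HodgeConjecture.HodgeConjecture.Cruxes.H413.F0P3cDyRamRamKFrameClassLetters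

end
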